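import Mathlib
import Summits.ValiantsHypothesis.ValiantsHypothesis.Cruxes.OrbitDimensionBound.Lines.TorsionLadder

/-!
# F3 SPECIAL-CASE WITNESSES for the rung `Torsion.SignShadow` (line `sign_covering`)

(a) the FLOOR is the family member `N = 0` — by `simpa` from the seed theorem (`t ^ 0 = 1` makes the torsion
conditions vacuous; the identification `torsionCovering_zero_iff` is `simp` + `rfl`);
(b) the floor's parameter value of the SHADOW form (the rung's shape) is a theorem two lines from the seed;
(c) rung ⇒ floor in both forms (numeric and shadow), one line each (`2 ∣ 0`);
(d) the relaxed symmetrisation target is implied by the host crux, one line;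
(e) the summit end of the dial, `N = 1`, is summit-strength (`TorsionCovering 1 → VP ≠ VNP`), one line — which is why
the rung is filed at `N = 2`.
[cite: LandsbergRessayre2017, Thm. 2.8]
-/

set_option linter.dupNamespace false

namespace Summit.ValiantsHypothesis.ValiantsHypothesis.Cruxes.OrbitDimensionBound.Torsion.Special

open Literature.Computability.AlgebraicComplexity
open Summit.ValiantsHypothesis.ValiantsHypothesis.Cruxes.OrbitDimensionBound.Confusion (CoveringShadow powLoss)
open Summit.ValiantsHypothesis.ValiantsHypothesis.Cruxes.OrbitDimensionBound.Torsion

/-- (a) the floor is the member `N = 0` of the family, by `simpa` from the seed. [cite: LandsbergRessayre2017, Thm. 2.8] -/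
example : TorsionCovering 0 := by
  simpa [torsionCovering_zero_iff] using
    Summit.ValiantsHypothesis.ValiantsHypothesis.Theorems.FreeSubtorusSubtorusCovering.subtorusCovering_proof

/-- (a') … the identification with the floor statement, by name. [cite: LandsbergRessayre2017, Thm. 2.8] -/
example : TorsionCovering 0 ↔ Summit.ValiantsHypothesis.ValiantsHypothesis.Theses.FreeSubtorus.SubtorusCovering :=
  torsionCovering_zero_iff

/-- (b) the rung's SHAPE (`TorsionShadow N`) at the floor's parameter `N = 0` is a theorem: seed + the tree's
`not_isPBounded_choose_middle`. [cite: LandsbergRessayre2017, Thm. 2.8] -/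
theorem floorShadow_of_seed : TorsionShadow 0 :=
  torsionShadow_of_torsionCovering (torsionCovering_zero_iff.2
    Summit.ValiantsHypothesis.ValiantsHypothesis.Theorems.FreeSubtorusSubtorusCovering.subtorusCovering_proof)

/-- (b') … and it is the floor's shadow `CoveringShadow 2^r` of the gen-1 family. [cite: LandsbergRessayre2017, Thm. 2.8] -/
example : TorsionShadow 0 ↔ CoveringShadow powLoss :=
  torsionShadow_zero_iff

/-- (c) rung ⇒ floor, numeric form. [cite: LandsbergRessayre2017, Thm. 2.8] -/
example (h : SignCovering) :
    Summit.ValiantsHypothesis.ValiantsHypothesis.Theses.FreeSubtorus.SubtorusCovering :=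
  subtorusCovering_of_signCovering h

/-- (c') rung ⇒ floor, shadow form. [cite: LandsbergRessayre2017, Thm. 2.8] -/
example (h : SignShadow) : CoveringShadow powLoss :=
  floorShadow_of_signShadow h

/-- (c'') dial monotonicity along divisibility, e.g. `SignCovering → TorsionCovering 4` and `TorsionCovering 1 →
SignCovering`. [folklore] -/
example (h : SignCovering) : TorsionCovering 4 := h.of_dvd (by norm_num)
example (h : TorsionCovering 1) : SignCovering := h.of_dvd (one_dvd 2)

/-- (d) the relaxed symmetrisation target follows from the host crux. [cite: LandsbergRessayre2017, Question 2.2] -/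
example (h : Summit.ValiantsHypothesis.ValiantsHypothesis.Theses.FreeSubtorus.OrbitDimensionBound) : OrbitSignBound :=
  orbitSignBound_of_orbitDimensionBound h

/-- (e) the summit end `N = 1` of the dial is summit-strength. [cite: BurgisserClausenShokrollahi1997, Cor. (21.40)] -/
example (h : TorsionCovering 1) : _root_.ValiantsHypothesis :=
  vh_of_torsionCovering_one h

end Summit.ValiantsHypothesis.ValiantsHypothesis.Cruxes.OrbitDimensionBound.Torsion.Special
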